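import Mathlib.Combinatorics.SetFamily.FourFunctions
import Mathlib.Tactic
import HarnessLib
import HarnessLib.Audit.Tags
import Summits.CriticalPhenomena.PercolationContinuityZ3.Theorems.PercNearOneGluingNoHeavyLowerTailSahiPartitionDaykin

/-!
# `PartitionSignedDaykin`: the faces `∅ ∈ P`, `F ∈ P`, and the COMPLETE families

Support file (seat `prim-masterthm-p1`, gen 43; `--supports stmt-CriticalPhenomena-4575`).  Pure proofs, no new definitions,
no `sorry`, standard axioms.  Memo `run/shared/lean/prim/prim-masterthm/FROM-prim-masterthm-p1-g43-TYPE-SETS.md`.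

CONTEXT.  `PartitionSignedDaykin` (gen 33, `…SahiPartitionDaykin`): for a complement-free family `P ⊆ 2^F` and ANY labelling
`κ : Finset α → ℕ` of its members, `#P ≤ #partDiffs F P κ`, where `partDiffs` = same-label differences ∪ different-label meets ∪
complemented different-label joins.  One label is Marica–Schönheim, three labels is `SignedColouredDaykin3`, injective labels is
the rainbow lemma (a kernel theorem since gen 42).  The general statement is OPEN.

NEW HERE ([this work], all elementary).
* `mem_or_sdiff_mem_partDiffs_of_empty_mem` / `…_of_mem_self`: if `∅ ∈ P` (resp. `F ∈ P`) then for every member `a ∈ P`,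
  `a` itself or its complement `F \ a` is a partition difference — for `∅` of the same label `a = a \ ∅`, of a different label
  `F \ a = F \ (a ∪ ∅)`; for `F` of a different label `a = a ∩ F`, of the same label `F \ a`.
* `card_le_card_partDiffs_of_empty_mem`, `card_le_card_partDiffs_of_mem_self`: hence **`PartitionSignedDaykin` holds for every
  labelling as soon as `∅ ∈ P` or `F ∈ P`** (the chosen elements `a` / `F \ a` are pairwise distinct because `P` has no
  complementary pair).  This is the partition-form (any number of labels) of gen 28's "dominated" face of `SignedColouredDaykin3`
  (`…SahiColouredDaykinDominated`, three colours, via Ahlswede–Daykin); the proof here is a three-line injection.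
* `card_le_card_partDiffs_of_complete`: in particular the conjecture holds for every COMPLETE complement-free family (one member
  of each complementary pair `{S, F \ S}`), since such a family contains `∅` or `F`.  The complete families are exactly the
  configurations on which the naive compression accounting of the memo (§3, frame F0) fails at every point for `|F| ≤ 4`.
HONEST FRAMING: faces only; `PartitionSignedDaykin`, `SignedColouredDaykin3`, `CrossSignedColouredDaykin3` remain OPEN (the crossing
configurations of the programme never contain `∅` or `F`). [this work]
-/

namespace Summit.CriticalPhenomena.PercolationContinuityZ3.Theorems.SahiColouredDaykin

open Finset

variable {α : Type*} [DecidableEq α]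

/-- Same-label differences are partition differences. [this work] -/
theorem sdiff_mem_partDiffs {F : Finset α} {P : Finset (Finset α)} {κ : Finset α → ℕ} {a b : Finset α}
    (ha : a ∈ P) (hb : b ∈ P) (hκ : κ a = κ b) : a \ b ∈ partDiffs F P κ := by
  unfold partDiffs
  exact mem_union.2 (Or.inl (mem_image.2 ⟨(a, b), mem_filter.2 ⟨mem_product.2 ⟨ha, hb⟩, hκ⟩, rfl⟩))

/-- Different-label meets are partition differences. [this work] -/
theorem inter_mem_partDiffs {F : Finset α} {P : Finset (Finset α)} {κ : Finset α → ℕ} {a b : Finset α}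
    (ha : a ∈ P) (hb : b ∈ P) (hκ : κ a ≠ κ b) : a ∩ b ∈ partDiffs F P κ := by
  unfold partDiffs
  exact mem_union.2 (Or.inr (mem_union.2 (Or.inl
    (mem_image.2 ⟨(a, b), mem_filter.2 ⟨mem_product.2 ⟨ha, hb⟩, hκ⟩, rfl⟩))))

/-- Complemented different-label joins are partition differences. [this work] -/
theorem sdiff_union_mem_partDiffs {F : Finset α} {P : Finset (Finset α)} {κ : Finset α → ℕ} {a b : Finset α}
    (ha : a ∈ P) (hb : b ∈ P) (hκ : κ a ≠ κ b) : F \ (a ∪ b) ∈ partDiffs F P κ := by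
  unfold partDiffs
  exact mem_union.2 (Or.inr (mem_union.2 (Or.inr
    (mem_image.2 ⟨(a, b), mem_filter.2 ⟨mem_product.2 ⟨ha, hb⟩, hκ⟩, rfl⟩))))

/-- **If `∅ ∈ P` then every member or its complement is a partition difference.** [this work] -/
theorem mem_or_sdiff_mem_partDiffs_of_empty_mem {F : Finset α} {P : Finset (Finset α)} (κ : Finset α → ℕ)
    (h0 : (∅ : Finset α) ∈ P) {a : Finset α} (ha : a ∈ P) :
    a ∈ partDiffs F P κ ∨ F \ a ∈ partDiffs F P κ := by
  by_cases hκ : κ a = κ ∅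
  · left
    have := sdiff_mem_partDiffs (F := F) ha h0 hκ
    rwa [sdiff_empty] at this
  · right
    have := sdiff_union_mem_partDiffs (F := F) ha h0 hκ
    rwa [union_empty] at this

/-- **If `F ∈ P` then every member or its complement is a partition difference.** [this work] -/
theorem mem_or_sdiff_mem_partDiffs_of_mem_self {F : Finset α} {P : Finset (Finset α)} (κ : Finset α → ℕ)
    (hPF : ∀ S ∈ P, S ⊆ F) (hF : F ∈ P) {a : Finset α} (ha : a ∈ P) :
    a ∈ partDiffs F P κ ∨ F \ a ∈ partDiffs F P κ := by
  by_cases hκ : κ a = κ F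
  · right
    exact sdiff_mem_partDiffs (F := F) hF ha hκ.symm
  · left
    have := inter_mem_partDiffs (F := F) ha hF hκ
    rwa [inter_eq_left.2 (hPF a ha)] at this

/-- The counting step: if every member of a complement-free `P ⊆ 2^F` has itself or its complement in a family `M`, then
`#P ≤ #M` (the chosen elements are pairwise distinct). [this work] -/
theorem card_le_card_of_mem_or_sdiff_mem {F : Finset α} {P M : Finset (Finset α)}
    (hPF : ∀ S ∈ P, S ⊆ F) (hcf : ∀ S ∈ P, F \ S ∉ P) (h : ∀ a ∈ P, a ∈ M ∨ F \ a ∈ M) : #P ≤ #M := by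
  classical
  -- the choice function
  let e : Finset α → Finset α := fun a => if a ∈ M then a else F \ a
  have he : ∀ a ∈ P, e a ∈ M := by
    intro a ha
    by_cases hM : a ∈ M
    · simp only [e, hM, if_true]
    · simp only [e, hM, if_false]
      exact (h a ha).resolve_left hM
  have hinj : Set.InjOn e ↑P := by
    intro a ha b hb hab
    have ha' : a ∈ P := mem_coe.1 ha
    have hb' : b ∈ P := mem_coe.1 hb
    by_cases hMa : a ∈ M <;> by_cases hMb : b ∈ M <;> simp only [e, hMa, hMb, if_true, if_false] at hab
    · exact hab
    · exact absurd (hab ▸ ha') (hcf b hb')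
    · exact absurd (hab ▸ hb') (hcf a ha')
    · rw [← Finset.sdiff_sdiff_eq_self (hPF a ha'), hab, Finset.sdiff_sdiff_eq_self (hPF b hb')]
  calc #P = #(P.image e) := (card_image_of_injOn hinj).symm
    _ ≤ #M := card_le_card (fun x hx => by
        obtain ⟨a, ha, rfl⟩ := mem_image.1 hx
        exact he a ha)

/-- **`PartitionSignedDaykin` when `∅ ∈ P`** (every labelling). [this work] -/
theorem card_le_card_partDiffs_of_empty_mem (F : Finset α) (P : Finset (Finset α)) (κ : Finset α → ℕ)
    (hPF : ∀ S ∈ P, S ⊆ F) (hcf : ∀ S ∈ P, F \ S ∉ P) (h0 : (∅ : Finset α) ∈ P) : #P ≤ #(partDiffs F P κ) :=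
  card_le_card_of_mem_or_sdiff_mem hPF hcf fun _ ha => mem_or_sdiff_mem_partDiffs_of_empty_mem κ h0 ha

/-- **`PartitionSignedDaykin` when `F ∈ P`** (every labelling). [this work] -/
theorem card_le_card_partDiffs_of_mem_self (F : Finset α) (P : Finset (Finset α)) (κ : Finset α → ℕ)
    (hPF : ∀ S ∈ P, S ⊆ F) (hcf : ∀ S ∈ P, F \ S ∉ P) (hF : F ∈ P) : #P ≤ #(partDiffs F P κ) :=
  card_le_card_of_mem_or_sdiff_mem hPF hcf fun _ ha => mem_or_sdiff_mem_partDiffs_of_mem_self κ hPF hF ha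

/-- **`PartitionSignedDaykin` for COMPLETE complement-free families** (every complementary pair `{S, F \ S}`, `S ⊆ F`, meets `P`):
such a family contains `∅` or `F`. [this work] -/
theorem card_le_card_partDiffs_of_complete (F : Finset α) (P : Finset (Finset α)) (κ : Finset α → ℕ)
    (hPF : ∀ S ∈ P, S ⊆ F) (hcf : ∀ S ∈ P, F \ S ∉ P) (hcomp : ∀ S ⊆ F, S ∈ P ∨ F \ S ∈ P) :
    #P ≤ #(partDiffs F P κ) := by
  rcases hcomp ∅ (empty_subset F) with h0 | hF
  · exact card_le_card_partDiffs_of_empty_mem F P κ hPF hcf h0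
  · rw [sdiff_empty] at hF
    exact card_le_card_partDiffs_of_mem_self F P κ hPF hcf hF

end Summit.CriticalPhenomena.PercolationContinuityZ3.Theorems.SahiColouredDaykin
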